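import Mathlib.RingTheory.Localization.LocalizationLocalization
import Mathlib.RingTheory.Localization.AtPrime.Basic
import Summits.ResolutionOfSingularities.ResolutionOfSingularities.Theorems.FrobeniusLadderFInjectiveMacaulayficationClauseLocalizes
import Summits.ResolutionOfSingularities.ResolutionOfSingularities.Theorems.FrobeniusLadderFInjectiveMacaulayficationDegreeZeroDescentLocal
import HarnessLib

/-!
# The stalk clause at the maximal ideals of a Noetherian ring gives it at all primes

Support file for crux stmt-ResolutionOfSingularities-15315 (`FrobeniusLadder.FInjectiveMacaulayfication`,
line `Sketch`, lead seat c4, cycle 5, wave 1): stub `stub_clauseOfMaximal` of the §6 BLOW-UP GLUE (E6)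
package. The stalks of `Bl_I(Spec R)` are the localizations `A_P` of the chart rings `A` at primes `P`,
while the certification engines (Fedder E2, deformation E1, degree-zero descent E4) deliver the crux's
per-stalk clause (domain; every system of parameters weakly regular with Frobenius closed ideal) only at the
MAXIMAL ideals of `A`. This file closes the gap for ANY Noetherian ring `A` of prime characteristic `p`:

* `fiClause_atPrime_of_le` — if `P ⊆ Q` are primes of `A` and the full clause holds for `A_Q`, it holds for
  `A_P`: `A_Q` is a Noetherian local ring of characteristic `p`; `P' = P·A_Q` is a prime of `A_Q` lying over
  `P` (`P` is disjoint from `A ∖ Q`); the clause localizes (E5, `ClauseLocalizes.fiClause_localization`) to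
  `(A_Q)_{P'}`, and `(A_Q)_{P'} ≅ A_P` (localization of a localization,
  `IsLocalization.isLocalization_atPrime_localization_atPrime` + `IsLocalization.algEquiv`); the clause
  transports along ring isomorphisms (`DegreeZeroDescent.inlineClause_of_ringEquiv`, `MulEquiv.isDomain`).
* `stub_clauseOfMaximal` — the registered form: clause at all `A_Q`, `Q` maximal ⇒ clause at all `A_P`,
  `P` prime (`Ideal.exists_le_maximal`).

References: folklore; for the "F-injectivity localizes" context see [QuyShimomoto2017] P. H. Quy,
K. Shimomoto, Adv. Math. 313 (2017) §3 and R. Datta, T. Murayama, "Permanence properties of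
F-injectivity" (2020) Prop. 3.3.
-/

-- single-problem summit: the doubled namespace component is forced
set_option linter.dupNamespace false

namespace Summit.ResolutionOfSingularities.ResolutionOfSingularities.Theorems.FInjectiveMacaulayfication.ClauseOfMaximal

open RingTheory.Sequence

/-- **Going down along `P ⊆ Q`.** In a Noetherian ring `A` of prime characteristic `p`, if `P ⊆ Q` are
primes and the local ring `A_Q` satisfies the full stalk clause of `FrobeniusLadder.FInjectiveMacaulayfication`
(domain; every system of parameters weakly regular with Frobenius closed ideal — inline form), then so does
`A_P ≅ (A_Q)_{P A_Q}` (E5 `ClauseLocalizes.fiClause_localization` + transport along the ring isomorphism).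
[folklore] -/
theorem fiClause_atPrime_of_le (p : ℕ) [Fact p.Prime] {A : Type} [CommRing A] [IsNoetherianRing A]
    [CharP A p] {P Q : Ideal A} [P.IsPrime] [Q.IsPrime] (hPQ : P ≤ Q)
    (hQ : IsDomain (Localization.AtPrime Q) ∧
      ∀ d : ℕ, ringKrullDim (Localization.AtPrime Q) = d → ∀ s : Fin d → Localization.AtPrime Q,
        (Ideal.span (Set.range s)).radical.IsMaximal →
          IsWeaklyRegular (Localization.AtPrime Q) (List.ofFn s) ∧
          ∀ y : Localization.AtPrime Q, (∃ e : ℕ, y ^ p ^ e ∈ Ideal.span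
            ((fun z : Localization.AtPrime Q => z ^ p ^ e) ''
              (Ideal.span (Set.range s) : Set (Localization.AtPrime Q)))) → y ∈ Ideal.span (Set.range s)) :
    IsDomain (Localization.AtPrime P) ∧
      ∀ d : ℕ, ringKrullDim (Localization.AtPrime P) = d → ∀ s : Fin d → Localization.AtPrime P,
        (Ideal.span (Set.range s)).radical.IsMaximal →
          IsWeaklyRegular (Localization.AtPrime P) (List.ofFn s) ∧
          ∀ y : Localization.AtPrime P, (∃ e : ℕ, y ^ p ^ e ∈ Ideal.span
            ((fun z : Localization.AtPrime P => z ^ p ^ e) ''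
              (Ideal.span (Set.range s) : Set (Localization.AtPrime P)))) → y ∈ Ideal.span (Set.range s) := by
  haveI : CharP (Localization.AtPrime Q) p := DegreeZeroDescent.charP_localization_atPrime p Q
  -- `P' = P · A_Q`, a prime of `A_Q` lying over `P`
  haveI hP' : (P.map (algebraMap A (Localization.AtPrime Q))).IsPrime :=
    Ideal.isPrime_map_of_isLocalizationAtPrime Q hPQ
  have hcomap : (P.map (algebraMap A (Localization.AtPrime Q))).comap
      (algebraMap A (Localization.AtPrime Q)) = P :=
    Ideal.under_map_of_isLocalizationAtPrime Q hPQ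
  -- E5: the clause localizes from the Noetherian local ring `A_Q` to `(A_Q)_{P'}`
  have hloc := ClauseLocalizes.fiClause_localization p hQ (P.map (algebraMap A (Localization.AtPrime Q)))
  -- `(A_Q)_{P'}` is the localization of `A` at `P`
  haveI : IsLocalization.AtPrime
      (Localization.AtPrime (P.map (algebraMap A (Localization.AtPrime Q)))) P := by
    have h := IsLocalization.isLocalization_atPrime_localization_atPrime (M := Q.primeCompl)
      (P.map (algebraMap A (Localization.AtPrime Q)))
    have hM : ((P.map (algebraMap A (Localization.AtPrime Q))).comap
        (algebraMap A (Localization.AtPrime Q))).primeCompl = P.primeCompl := by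
      ext x
      rw [Ideal.mem_primeCompl_iff, Ideal.mem_primeCompl_iff, hcomap]
    change IsLocalization P.primeCompl _
    rw [← hM]
    exact h
  let e : Localization.AtPrime (P.map (algebraMap A (Localization.AtPrime Q))) ≃+*
      Localization.AtPrime P :=
    (IsLocalization.algEquiv P.primeCompl
      (Localization.AtPrime (P.map (algebraMap A (Localization.AtPrime Q)))) (Localization.AtPrime P)).toRingEquiv
  haveI := hloc.1
  exact ⟨MulEquiv.isDomain _ e.symm.toMulEquiv, DegreeZeroDescent.inlineClause_of_ringEquiv p e hloc.2⟩

/-- **E5 COROLLARY (helper stub `stub_clauseOfMaximal`)**: in a Noetherian ring `A` of prime characteristic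
`p`, if the local rings at the MAXIMAL ideals satisfy the full stalk clause (domain, every system of parameters
weakly regular, parameter ideals Frobenius closed), then so do the local rings at ALL primes (`P ⊆ Q` maximal,
`A_P ≅ (A_Q)_{P A_Q}`, `ClauseLocalizes.fiClause_localization`). [folklore] -/
theorem stub_clauseOfMaximal : ∀ (p : ℕ) [Fact p.Prime] (A : Type) [CommRing A] [IsNoetherianRing A] [CharP A p],
    (∀ (Q : Ideal A) [Q.IsMaximal], IsDomain (Localization.AtPrime Q) ∧
      ∀ d : ℕ, ringKrullDim (Localization.AtPrime Q) = d → ∀ s : Fin d → Localization.AtPrime Q,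
        (Ideal.span (Set.range s)).radical.IsMaximal →
          RingTheory.Sequence.IsWeaklyRegular (Localization.AtPrime Q) (List.ofFn s) ∧
          ∀ y : Localization.AtPrime Q, (∃ e : ℕ, y ^ p ^ e ∈ Ideal.span
            ((fun z : Localization.AtPrime Q => z ^ p ^ e) ''
              (Ideal.span (Set.range s) : Set (Localization.AtPrime Q)))) → y ∈ Ideal.span (Set.range s)) →
    ∀ (P : Ideal A) [P.IsPrime], IsDomain (Localization.AtPrime P) ∧
      ∀ d : ℕ, ringKrullDim (Localization.AtPrime P) = d → ∀ s : Fin d → Localization.AtPrime P,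
        (Ideal.span (Set.range s)).radical.IsMaximal →
          RingTheory.Sequence.IsWeaklyRegular (Localization.AtPrime P) (List.ofFn s) ∧
          ∀ y : Localization.AtPrime P, (∃ e : ℕ, y ^ p ^ e ∈ Ideal.span
            ((fun z : Localization.AtPrime P => z ^ p ^ e) ''
              (Ideal.span (Set.range s) : Set (Localization.AtPrime P)))) → y ∈ Ideal.span (Set.range s) := by
  intro p _ A _ _ _ hmax P _
  obtain ⟨Q, hQmax, hPQ⟩ := Ideal.exists_le_maximal P (Ideal.IsPrime.ne_top inferInstance)
  exact fiClause_atPrime_of_le p hPQ (hmax Q)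

end Summit.ResolutionOfSingularities.ResolutionOfSingularities.Theorems.FInjectiveMacaulayfication.ClauseOfMaximal
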